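import Summits.HodgeConjecture.HodgeConjecture.Theorems.NikulinTwinTransportSquareTranscendental
import Summits.HodgeConjecture.HodgeConjecture.Theorems.NikulinTwinTransportRealMultiplicationFibreIntegral
import Literature.AlgebraicGeometry.HodgeTheory.GysinBaseChange

/-!
# Route NikulinTwinTransport · crux `HodgeSimilitudeAlgebraic` (stmt-HodgeConjecture-13676) —
# divisorial correspondences between two K3 surfaces are algebraic

First half of the TRANSCENDENTAL REDUCTION of the crux (and of the target X,
stmt-HodgeConjecture-13674): a rational Hodge similitude `ψ : H²(S′) → H²(S)` between projective
K3 surfaces splits along `H² = NS ⊕ T` (Néron–Severi classes `N¹H²` and their cup-orthogonal, the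
transcendental classes), and its Néron–Severi part is algebraic for free — it is a combination of
products of divisors (Huybrechts 2019 §1, Varesco 2023 §2: a similitude and its transcendental part
"differ by divisor classes"). This file proves the free part on the tree's real carriers, for two
DIFFERENT surfaces, unconditionally except for the Hodge index theorem on `S′`:

* `exists_divisorCorrespondence_two` — for smooth projective surfaces `S, S′`, algebraic divisor
  classes `a ∈ N¹H²(S′)`, `b ∈ N¹H²(S)` and `0 ≠ p′ ∈ H⁴(S′(ℂ))`, the rank-one map `y ↦ t · b`
  (`y ∪ a = t · p′`) is `[γ]_* = fst_*(snd^*(–) ∪ γ)` for the algebraic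
  `γ = c⁻¹ · fst^* b ∪ snd^* a` (exterior products of algebraic classes are algebraic,
  `cupProduct_map_fst_map_snd_mem_algebraicClasses`; fibre integral `fst_* snd^* p′ = c · 1`, `c ≠ 0`,
  `fibreIntegral_of_kunnethTop` with the Künneth theorem `kunnethSpan_complexBetti`; projection
  formula `complexGysin_cup`) — the two-surface form of `divisorCorrespondence_of_fibreIntegral`;
* `corr_add`, `corr_sum` — `[γ]_*` is additive in `γ`;
* `exists_nsProjection₀` — for a marked projective K3 surface, `H² = N ⊕ T` with its projection
  onto `N = N¹H²` along `T` (the decomposition half of `exists_nsProjection`, with no Hodge-type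
  clause and hence no `CupPreservesHodgeType` input; Hodge index via
  `exists_mem_add_mem_of_isRationalClass`);
* `exists_algebraic_of_divisorial` — **every `ℂ`-linear `E : H²(S′(ℂ); ℂ) → H²(S(ℂ); ℂ)` that
  kills `T(S′)` and carries `N¹H²(S′)` into `N¹H²(S)` is `[γ]_*` for an algebraic
  `γ ∈ N²H⁴((S ⊗ S′)(ℂ))`** (`S, S′` projective K3, `S′` marked; granted `hodgeIndex_surface S′`).

The second half (`…HodgeSimilitudeAlgebraicTranscendental`) feeds this with
`E = ψ − [γ_T]_*` for a class `γ_T` inducing `ψ` on `T(S′)` only. No definitions, no `sorry`,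
axioms `propext`, `Classical.choice`, `Quot.sound`. Prover seat
prover-HodgeConjecture-route-HodgeConjecture-NikulinTwinTransport-3.

## References

* [Huybrechts2019] D. Huybrechts, Motives of isogenous K3 surfaces, Comment. Math. Helv. 94 (2019), §1.
* [Varesco2023] M. Varesco, Hodge similarities, algebraic classes, and Kuga–Satake varieties,
  Math. Z. 305 (2023), §2.
* [Fulton1998] W. Fulton, Intersection Theory, 2nd ed. (1998), §16.1 Def. 16.1.1.
* [FultonYoungTableaux1997] W. Fulton, Young Tableaux (1997), Appendix B §B.1 (3)–(6).
* [Huybrechts2016K3] D. Huybrechts, Lectures on K3 Surfaces (2016), Ch. 3 §2.2, Lemma 3.3.1.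
* [Hartshorne1977] R. Hartshorne, Algebraic Geometry (1977), V Thm. 1.9, Rem. 1.9.1.
-/

noncomputable section

open CategoryTheory MonoidalCategory SemiCartesianMonoidalCategory
open scoped Manifold
open Literature.AlgebraicGeometry.Motives Literature.AlgebraicGeometry.HodgeTheory
open Literature.AlgebraicGeometry.Surfaces Literature.Geometry.Kaehler
open Literature.AlgebraicTopology.SingularHomology

namespace Summit.HodgeConjecture.HodgeConjecture.Theorems.NikulinTwinTransport

/-! ### Divisor correspondences between two surfaces -/

section TwoSurfaces

variable (μ : OrientationFamily) {S S' : SchemeOver ℂ}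
  (hS : IsSmoothProjective 2 S) (hS' : IsSmoothProjective 2 S')

/-- **The rank-one correspondence `y ↦ t · b` (`y ∪ a = t · p′`) between two smooth projective
surfaces is algebraic** for algebraic divisor classes `a ∈ N¹H²(S′)`, `b ∈ N¹H²(S)` and a non-zero
class `p′ ∈ H⁴(S′(ℂ))`: it is `[γ]_* = fst_*(snd^*(–) ∪ γ)` for `γ = c⁻¹ · fst^* b ∪ snd^* a`
(an exterior product of algebraic classes, `cupProduct_map_fst_map_snd_mem_algebraicClasses`),
where `fst_*(snd^* p′) = c · 1_S`, `c ≠ 0`, is the fibre integral (`fibreIntegral_of_kunnethTop`,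
unconditional since the Künneth spanning property `kunnethSpan_complexBetti` is a theorem).
Computation: `snd^* y ∪ (fst^* b ∪ snd^* a) = fst^* b ∪ snd^*(y ∪ a) = t · (fst^* b ∪ snd^* p′)`
and `fst_*(fst^* b ∪ snd^* p′) = b ∪ fst_* snd^* p′ = c · b` (projection formula
`complexGysin_cup`). The two-surface form of seat 3's `divisorCorrespondence_of_fibreIntegral`.
[cite: Fulton1998, §16.1 Def. 16.1.1] [cite: FultonYoungTableaux1997, Appendix B §B.1 (3), (6)] -/
theorem exists_divisorCorrespondence_two (hμ : μ.HasPoincareDuality) {p' : complexBetti S' (2 * 2)}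
    (hp' : p' ≠ 0) {a : complexBetti S' (2 * 1)} {b : complexBetti S (2 * 1)}
    (ha : a ∈ algebraicClasses S' 1) (hb : b ∈ algebraicClasses S 1) :
    ∃ γ ∈ algebraicClasses (S ⊗ S') 2, ∀ (y : complexBetti S' (2 * 1)) (t : ℂ),
      cupProduct (rfl : 2 * 1 + 2 * 1 = 2 * 2) y a = t • p' →
        complexGysin μ (IsSmoothProjective.tensor_holds hS hS') hS (fst S S')
            (rfl : 2 * 1 + 2 * 2 + 2 * 2 = 2 * 1 + 2 * (2 + 2))
            (cupProduct (rfl : 2 * 1 + 2 * 2 = 2 * 1 + 2 * 2)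
              (complexBetti.map (snd S S') (2 * 1) y) γ) = t • b := by
  -- the fibre integral `fst_* snd^* p' = c • 1`, `c ≠ 0`
  obtain ⟨c, hc, hκ⟩ := fibreIntegral_of_kunnethTop μ hS hS'
    (fun z ↦ kunnethSpan_complexBetti hS hS' _ z) hp'
  -- the exterior product `γ₀ = fst^* b ∪ snd^* a`, algebraic
  set γ₀ : complexBetti (S ⊗ S') (2 * 2) := cupProduct (rfl : 2 * 1 + 2 * 1 = 2 * 2)
    (complexBetti.map (fst S S') (2 * 1) b) (complexBetti.map (snd S S') (2 * 1) a) with hγ₀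
  have hγ₀alg : γ₀ ∈ algebraicClasses (S ⊗ S') 2 :=
    cupProduct_fst_snd_mem_algebraicClasses_of_eq hS hS' hb ha (rfl : 1 + 1 = 2) _
  refine ⟨c⁻¹ • γ₀, Submodule.smul_mem _ _ hγ₀alg, fun y t hya => ?_⟩
  have hcomm : cupProduct (rfl : 2 * 1 + 2 * 1 = 2 * 2) (complexBetti.map (snd S S') (2 * 1) y)
      (complexBetti.map (fst S S') (2 * 1) b) =
      cupProduct (rfl : 2 * 1 + 2 * 1 = 2 * 2) (complexBetti.map (fst S S') (2 * 1) b)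
        (complexBetti.map (snd S S') (2 * 1) y) := by
    rw [cupProduct_gradedComm_holds ℂ _ (rfl : 2 * 1 + 2 * 1 = 2 * 2) rfl]
    norm_num
  have hnat : cupProduct (rfl : 2 * 1 + 2 * 1 = 2 * 2) (complexBetti.map (snd S S') (2 * 1) y)
      (complexBetti.map (snd S S') (2 * 1) a) = t • complexBetti.map (snd S S') (2 * 2) p' := by
    rw [complexBetti.map, complexBetti.map, ← cupProduct_map, hya, map_smul]
  have h1 : cupProduct (rfl : 2 * 1 + 2 * 2 = 2 * 1 + 2 * 2)
      (complexBetti.map (snd S S') (2 * 1) y) γ₀ =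
      t • cupProduct (rfl : 2 * 1 + 2 * 2 = 2 * 1 + 2 * 2) (complexBetti.map (fst S S') (2 * 1) b)
        (complexBetti.map (snd S S') (2 * 2) p') := by
    rw [hγ₀, ← cupProduct_assoc (rfl : 2 * 1 + 2 * 1 = 2 * 2) (rfl : 2 * 1 + 2 * 1 = 2 * 2)
      (rfl : 2 * 2 + 2 * 1 = 2 * 1 + 2 * 2) (rfl : 2 * 1 + 2 * 2 = 2 * 1 + 2 * 2), hcomm,
      cupProduct_assoc (rfl : 2 * 1 + 2 * 1 = 2 * 2) (rfl : 2 * 1 + 2 * 1 = 2 * 2)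
      (rfl : 2 * 2 + 2 * 1 = 2 * 1 + 2 * 2) (rfl : 2 * 1 + 2 * 2 = 2 * 1 + 2 * 2), hnat, map_smul]
  have h2 : complexGysin μ (IsSmoothProjective.tensor_holds hS hS') hS (fst S S')
      (rfl : 2 * 1 + 2 * 2 + 2 * 2 = 2 * 1 + 2 * (2 + 2))
      (cupProduct (rfl : 2 * 1 + 2 * 2 = 2 * 1 + 2 * 2) (complexBetti.map (fst S S') (2 * 1) b)
        (complexBetti.map (snd S S') (2 * 2) p')) = c • b := by
    rw [complexGysin_cup hμ (IsSmoothProjective.tensor_holds hS hS') hS (fst S S')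
      (rfl : 2 * 1 + 2 * 2 = 2 * 1 + 2 * 2) (rfl : 2 * 1 + 2 * 2 + 2 * 2 = 2 * 1 + 2 * (2 + 2))
      (rfl : 2 * 2 + 2 * 2 = 0 + 2 * (2 + 2)) (rfl : 2 * 1 + 0 = 2 * 1), hκ, map_smul, cupProduct_one]
  have hct : c⁻¹ * t * c = t := by field_simp
  rw [map_smul, map_smul, h1, map_smul, h2, smul_smul, smul_smul, hct]

/-- The correspondence action `y ↦ [γ]_* y = fst_*(snd^* y ∪ γ)` of a class
`γ ∈ H⁴((S ⊗ S′)(ℂ))` is additive in `γ`. [cite: Fulton1998, §16.1] -/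
theorem corr_add (γ₁ γ₂ : complexBetti (S ⊗ S') (2 * 2)) (y : complexBetti S' (2 * 1)) :
    complexGysin μ (IsSmoothProjective.tensor_holds hS hS') hS (fst S S')
        (rfl : 2 * 1 + 2 * 2 + 2 * 2 = 2 * 1 + 2 * (2 + 2))
        (cupProduct (rfl : 2 * 1 + 2 * 2 = 2 * 1 + 2 * 2)
          (complexBetti.map (snd S S') (2 * 1) y) (γ₁ + γ₂)) =
      complexGysin μ (IsSmoothProjective.tensor_holds hS hS') hS (fst S S')
          (rfl : 2 * 1 + 2 * 2 + 2 * 2 = 2 * 1 + 2 * (2 + 2))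
          (cupProduct (rfl : 2 * 1 + 2 * 2 = 2 * 1 + 2 * 2)
            (complexBetti.map (snd S S') (2 * 1) y) γ₁) +
        complexGysin μ (IsSmoothProjective.tensor_holds hS hS') hS (fst S S')
          (rfl : 2 * 1 + 2 * 2 + 2 * 2 = 2 * 1 + 2 * (2 + 2))
          (cupProduct (rfl : 2 * 1 + 2 * 2 = 2 * 1 + 2 * 2)
            (complexBetti.map (snd S S') (2 * 1) y) γ₂) := by
  rw [map_add, map_add]

/-- The correspondence action `[γ]_* y` is additive over finite sums of classes `γᵢ`.
[cite: Fulton1998, §16.1] -/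
theorem corr_sum {ι : Type*} (s : Finset ι) (γ : ι → complexBetti (S ⊗ S') (2 * 2))
    (y : complexBetti S' (2 * 1)) :
    complexGysin μ (IsSmoothProjective.tensor_holds hS hS') hS (fst S S')
        (rfl : 2 * 1 + 2 * 2 + 2 * 2 = 2 * 1 + 2 * (2 + 2))
        (cupProduct (rfl : 2 * 1 + 2 * 2 = 2 * 1 + 2 * 2)
          (complexBetti.map (snd S S') (2 * 1) y) (∑ i ∈ s, γ i)) =
      ∑ i ∈ s, complexGysin μ (IsSmoothProjective.tensor_holds hS hS') hS (fst S S')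
          (rfl : 2 * 1 + 2 * 2 + 2 * 2 = 2 * 1 + 2 * (2 + 2))
          (cupProduct (rfl : 2 * 1 + 2 * 2 = 2 * 1 + 2 * 2)
            (complexBetti.map (snd S S') (2 * 1) y) (γ i)) := by
  rw [map_sum, map_sum]

end TwoSurfaces

/-! ### The projection of `H²` of a marked projective K3 surface onto its Néron–Severi classes -/

section Marked

variable {S : SchemeOver ℂ} (hK3 : IsK3Surface S)
  (η : complexBetti S (2 * 1) ≃ₗ[ℂ] (K3Index → ℂ)) {p : complexBetti S (2 * 2)} (hp0 : p ≠ 0)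
  (hint : ∀ c : complexBetti S (2 * 1), IsIntegralClass c ↔ ∃ v : K3Index → ℤ, η c = fun i => (v i : ℂ))
  (hcup : ∀ a b : complexBetti S (2 * 1),
    cupProduct (rfl : 2 * 1 + 2 * 1 = 2 * 2) a b = k3Form (η a) (η b) • p)

include hK3 hp0 hint hcup in
/-- **`H²(S(ℂ); ℂ) = N ⊕ T` for a marked projective K3 surface, bare form**: with
`N = algebraicClasses S 1` and `T = {t | t ∪ d = 0 ∀ d ∈ N}`, there is a linear projection `π`
onto `N` along `T` (image in `N`, the identity on `N`, zero on `T`, and `x - π x ∈ T`). This is the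
decomposition half of seat 3's `exists_nsProjection` (Hodge index on the rational algebraic classes,
`exists_mem_add_mem_of_isRationalClass`, plus the dimension count with the non-degenerate cup form),
WITHOUT its Hodge-type clauses — hence without any `CupPreservesHodgeType` input.
[cite: Huybrechts2016K3, Ch. 3 §2.2 and Lemma 3.3.1] [cite: Hartshorne1977, V Rem. 1.9.1] -/
theorem exists_nsProjection₀ (hHI : hodgeIndex_surface S) :
    ∃ π : complexBetti S (2 * 1) →ₗ[ℂ] complexBetti S (2 * 1),
      (∀ x, π x ∈ algebraicClasses S 1) ∧
      (∀ d ∈ algebraicClasses S 1, π d = d) ∧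
      (∀ t, (∀ d ∈ algebraicClasses S 1, cupProduct (rfl : 2 * 1 + 2 * 1 = 2 * 2) t d = 0) → π t = 0) ∧
      (∀ x, ∀ d ∈ algebraicClasses S 1, cupProduct (rfl : 2 * 1 + 2 * 1 = 2 * 2) (x - π x) d = 0) := by
  haveI : FiniteDimensional ℂ (complexBetti S (2 * 1)) := LinearEquiv.finiteDimensional η.symm
  set N : Submodule ℂ (complexBetti S (2 * 1)) := algebraicClasses S 1 with hNdef
  set Bf : LinearMap.BilinForm ℂ (complexBetti S (2 * 1)) :=
    k3FormC.compl₁₂ η.toLinearMap η.toLinearMap with hBf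
  set T : Submodule ℂ (complexBetti S (2 * 1)) := Bf.orthogonal N with hTdef
  have memT : ∀ x, x ∈ T ↔ ∀ d ∈ N, cupProduct (rfl : 2 * 1 + 2 * 1 = 2 * 2) x d = 0 :=
    mem_orthogonal_iff η hp0 hcup
  -- `N + T = V`: every basis class `η⁻¹ eₖ` decomposes
  have hsup : N ⊔ T = ⊤ := by
    rw [eq_top_iff, ← (((Pi.basisFun ℂ K3Index).map η.symm).span_eq), Submodule.span_le]
    rintro _ ⟨k, rfl⟩
    have hk : IsRationalClass (((Pi.basisFun ℂ K3Index).map η.symm) k) := by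
      rw [Module.Basis.map_apply, basisFun_eq_ratCastΛ]
      exact (isRationalClass_iff_of_marking hK3 η hint _).2 ⟨_, η.apply_symm_apply _⟩
    obtain ⟨n, t, hn, -, ht, -, hnt⟩ := exists_mem_add_mem_of_isRationalClass hK3 η hint hcup hHI hk
    rw [SetLike.mem_coe, hnt]
    exact Submodule.add_mem_sup hn ((memT t).2 ht)
  -- `dim N + dim T = dim V`, hence `N ∩ T = 0`
  have hinf : N ⊓ T = ⊥ := by
    have h1 := Submodule.finrank_sup_add_finrank_inf_eq N T
    rw [hsup, finrank_top] at h1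
    have h2 : Module.finrank ℂ N + Module.finrank ℂ T = Module.finrank ℂ (complexBetti S (2 * 1)) := by
      have := LinearMap.BilinForm.finrank_add_finrank_orthogonal (isSymm_cupForm η).isRefl N
      rwa [LinearMap.BilinForm.orthogonal_top_eq_bot (nondegenerate_cupForm η), inf_bot_eq, finrank_bot,
        add_zero] at this
    refine Submodule.finrank_eq_zero.1 ?_
    omega
  have hc : IsCompl N T := IsCompl.of_eq hinf hsup
  exact ⟨N.projection T hc, fun x ↦ Submodule.projection_apply_mem hc x,
    fun d hd ↦ Submodule.projection_apply_of_mem_left hc hd,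
    fun t ht ↦ (Submodule.projection_apply_eq_zero_iff hc).2 ((memT t).2 ht),
    fun x ↦ (memT _).1 (Submodule.sub_projection_mem hc x)⟩

end Marked

/-! ### Divisorial maps `H²(S′) → H²(S)` are algebraic correspondences -/

/-- **A divisorial linear map between the second cohomologies of two projective K3 surfaces is an
algebraic correspondence.** Let `S, S′` be projective K3 surfaces, `S′` marked (`η′`, generator
`p′ ≠ 0` of `H⁴`, integral classes `= Λ`, cup form `= k3Form • p′`), and let
`E : H²(S′(ℂ); ℂ) → H²(S(ℂ); ℂ)` be `ℂ`-linear, ZERO on the transcendental classes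
`T(S′) = {t | t ∪ d′ = 0 ∀ d′ ∈ N¹H²(S′)}` and carrying `N¹H²(S′)` into `N¹H²(S)`. Then
`E = [γ]_* = fst_*(snd^*(–) ∪ γ)` for an ALGEBRAIC `γ ∈ N²H⁴((S ⊗ S′)(ℂ))`, namely a combination
of exterior products of divisor classes: `E = E ∘ π′` for the projection `π′` onto `N¹H²(S′)`
along `T(S′)` (`exists_nsProjection₀`, Hodge index), `π′ = Σᵢ (–.aᵢ) bᵢ` with `aᵢ, bᵢ ∈ N¹H²(S′)`
(`exists_rankOne_of_range_le`), and each `y ↦ (y.aᵢ) E bᵢ` is `[γᵢ]_*` for an exterior product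
`γᵢ` (`exists_divisorCorrespondence_two`). Granted: the Hodge index theorem for `S′`
(`hodgeIndex_surface S′`). [cite: Huybrechts2019, §1 ("ψ ⊕ ν … differ by divisor classes")]
[cite: Fulton1998, §16.1] [cite: Huybrechts2016K3, Ch. 3 Lemma 3.3.1] -/
theorem exists_algebraic_of_divisorial (μ : OrientationFamily) (hμ : μ.HasPoincareDuality)
    {S S' : SchemeOver ℂ} (hS : IsK3Surface S) (hS' : IsK3Surface S')
    (η' : complexBetti S' (2 * 1) ≃ₗ[ℂ] (K3Index → ℂ)) {p' : complexBetti S' (2 * 2)} (hp'0 : p' ≠ 0)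
    (hint' : ∀ c : complexBetti S' (2 * 1),
      IsIntegralClass c ↔ ∃ v : K3Index → ℤ, η' c = fun i => (v i : ℂ))
    (hcup' : ∀ a b : complexBetti S' (2 * 1),
      cupProduct (rfl : 2 * 1 + 2 * 1 = 2 * 2) a b = k3Form (η' a) (η' b) • p')
    (hHI' : hodgeIndex_surface S')
    (E : complexBetti S' (2 * 1) →ₗ[ℂ] complexBetti S (2 * 1))
    (hET : ∀ t, (∀ d' ∈ algebraicClasses S' 1,
      cupProduct (rfl : 2 * 1 + 2 * 1 = 2 * 2) t d' = 0) → E t = 0)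
    (hEN : ∀ d' ∈ algebraicClasses S' 1, E d' ∈ algebraicClasses S 1) :
    ∃ γ ∈ algebraicClasses (S ⊗ S') 2, ∀ y : complexBetti S' (2 * 1),
      E y = complexGysin μ
        (IsSmoothProjective.tensor_holds hS.isSmoothProjective hS'.isSmoothProjective)
        hS.isSmoothProjective (fst S S')
        (rfl : 2 * 1 + 2 * 2 + 2 * 2 = 2 * 1 + 2 * (2 + 2))
        (cupProduct (rfl : 2 * 1 + 2 * 2 = 2 * 1 + 2 * 2)
          (complexBetti.map (snd S S') (2 * 1) y) γ) := by
  obtain ⟨π, hπN, -, hπT, hπsub⟩ := exists_nsProjection₀ hS' η' hp'0 hint' hcup' hHI'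
  obtain ⟨m, a, b, ha, hb, hπeq⟩ := exists_rankOne_of_range_le η' hp'0 hcup' π hπN hπT
  have key : ∀ i : Fin m, ∃ γ ∈ algebraicClasses (S ⊗ S') 2,
      ∀ (y : complexBetti S' (2 * 1)) (t : ℂ),
        cupProduct (rfl : 2 * 1 + 2 * 1 = 2 * 2) y (a i) = t • p' →
          complexGysin μ
            (IsSmoothProjective.tensor_holds hS.isSmoothProjective hS'.isSmoothProjective)
            hS.isSmoothProjective (fst S S')
            (rfl : 2 * 1 + 2 * 2 + 2 * 2 = 2 * 1 + 2 * (2 + 2))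
            (cupProduct (rfl : 2 * 1 + 2 * 2 = 2 * 1 + 2 * 2)
              (complexBetti.map (snd S S') (2 * 1) y) γ) = t • E (b i) := fun i ↦
    exists_divisorCorrespondence_two μ hS.isSmoothProjective hS'.isSmoothProjective hμ hp'0 (ha i)
      (hEN _ (hb i))
  choose γ hγalg hγact using key
  refine ⟨∑ i, γ i, Submodule.sum_mem _ fun i _ ↦ hγalg i, fun y ↦ ?_⟩
  have hy : E y = E (π y) := by
    have h := hET (y - π y) (hπsub y)
    rwa [map_sub, sub_eq_zero] at h
  rw [corr_sum μ hS.isSmoothProjective hS'.isSmoothProjective, hy, hπeq y, map_sum]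
  refine Finset.sum_congr rfl fun i _ ↦ ?_
  rw [map_smul, hγact i y (k3Form (η' y) (η' (a i))) (hcup' y (a i))]


end Summit.HodgeConjecture.HodgeConjecture.Theorems.NikulinTwinTransport

end
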